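import Summits.AtomisticToContinuum.BoseEinsteinCondensation.Theorems.BECInfDivCoherenceLevyNegativeMomentGridMeanLog
import Summits.AtomisticToContinuum.BoseEinsteinCondensation.Theorems.BECInfDivCoherenceLevyMassCondensationEnergy
import Summits.AtomisticToContinuum.BoseEinsteinCondensation.Theorems.BECInfDivCoherenceGridAverageCondensate

/-!
# Crux `LevyNegativeMoment` (stmt-AtomisticToContinuum-9115) — target strength of the crux and of
# its stub `stub_logClusterL1` (route `BECInfDivCoherence`, line `registered`, lead cycle 2; part 2 of 2)

Kernel-checked form of the structural finding of the line (lead c1, `stub_logClusterL1.assessment.md`: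
"`LogClusterL1 ∧ (G > 0 on the grid)` already implies the route target"; lead c2, this file and
`…LevyNegativeMomentGridMeanLog.lean`).  With `G_Ψ`, `F = log G_Ψ ∘ grid`, `ν̃` as in part 1:

* `periodicBEC_of_gridMeanLog_of_coherencePos` — an `N`- and `ρ`-uniform floor `−Λ(v, η)` under the
  grid mean of `log G_Ψ` of near-minimisers (part 1 derives it from the crux AND from the stub),
  together with POSITIVITY of the coherence of near-minimisers (the first conjunct of the sister crux
  `GridInfDivCoherence`, nothing of its sign condition `ν̃ ≥ −ε`) and the proved support
  `GridAverageCondensate`, gives constant-mode condensation of near-minimisers at every small density —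
  verbatim the conclusion of the glue item `LevyMassCondensation` (= the body of
  `BECPeriodicReduction.PeriodicBEC`, stmt-0826): AM–GM on the grid and the Dyson–LSSY energy ceiling,
  as in `levyMassCondensation_proof` but without the f-sum, Jordan and Hölder steps; only the grid
  scale `η = 1` is used.
* `coherencePos_of_gridInfDivCoherence` — positivity is the first conjunct of `GridInfDivCoherence`.
* `periodicBEC_of_levyNegativeMoment_of_coherencePos`,
  `periodicBEC_of_gridInfDivCoherence_pos_of_levyNegativeMoment` — THE CRUX IS TARGET-STRENGTH:
  `LevyNegativeMoment` + positivity already gives the route target (with `GridAverageCondensate`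
  discharged by `gridAverageCondensate_proof`); the negative-type clause of `GridInfDivCoherence` is
  idle in the route's deciding theorem, and only the `ρ`-uniformity of `C` at one scale is used.
* `periodicBEC_of_logClusterL1_of_coherencePos` — THE STUB IS TARGET-STRENGTH (`promote-stub`, lead
  c1, made kernel-checked): the registered stub `stub_logClusterL1` + positivity already gives the route
  target, bypassing the line's other stubs and the crux.

No claim is made about the truth of the crux or the stub.
-/

noncomputable section


namespace Summit.AtomisticToContinuum.BoseEinsteinCondensation.Theorems

open MeasureTheory Filter Literature.MathematicalPhysics.QuantumManyBody.BoseGas InfDivGlue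
open scoped ENNReal ComplexConjugate

/-! ### Condensation from a grid-mean floor and positivity -/

/-- **Constant-mode BEC from a uniform floor under the grid mean of `log G_Ψ` and positivity of the
coherence.** If near-minimisers have `m⁻³ Σ_j log G_Ψ((L/m)j) ≥ −Λ(v, η)` uniformly in `N` and
`ρ < ρ₀` (at every grid scale `η`; only `η = 1` is used) and strictly positive translation coherence,
then — by AM–GM on the grid, the aliasing support `GridAverageCondensate` with the Dyson–LSSY
ceiling `E₀^per ≤ 16πRρN`, and `h = L/m ≤ 2` — `condensateOccupation ≥ cN` with
`c = e^{−Λ}/2` for all small `ρ` and large `N`: verbatim the conclusion of the route's glue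
`LevyMassCondensation` (body of `BECPeriodicReduction.PeriodicBEC`, stmt-0826). [folklore] -/
theorem periodicBEC_of_gridMeanLog_of_coherencePos
    (hpos : ∀ v : ℝ → ℝ≥0∞, IsRepulsiveFiniteRange v → ∃ ρ₀ : ℝ, 0 < ρ₀ ∧
      ∀ ρ : ℝ, 0 < ρ → ρ < ρ₀ → ∀ᶠ N : ℕ in atTop, ∃ δ : ℝ≥0∞, 0 < δ ∧
        ∀ Ψ : PeriodicTrialState N (sideLength ρ N),
          periodicEnergy v Ψ ≤ periodicGroundStateEnergy v N (sideLength ρ N) + δ → ∀ i : Fin N,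
            ∀ r, 0 < (∫ X in cellN N (sideLength ρ N),
              conj (Ψ.ψ (Function.update X i (X i + r))) * Ψ.ψ X).re)
    (hmean : ∀ v : ℝ → ℝ≥0∞, IsRepulsiveFiniteRange v → ∀ η : ℝ, 0 < η → ∃ Λ : ℝ, ∃ ρ₀ : ℝ, 0 < ρ₀ ∧
      ∀ ρ : ℝ, 0 < ρ → ρ < ρ₀ → ∀ᶠ N : ℕ in atTop, ∃ δ : ℝ≥0∞, 0 < δ ∧
        ∀ Ψ : PeriodicTrialState N (sideLength ρ N),
          periodicEnergy v Ψ ≤ periodicGroundStateEnergy v N (sideLength ρ N) + δ → ∀ i : Fin N,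
            let L : ℝ := sideLength ρ N; let m : ℕ := ⌊L / η⌋₊;
            -Λ ≤ (∑ j : Fin 3 → Fin m, Real.log ((∫ X in cellN N L,
              conj (Ψ.ψ (Function.update X i (X i + latticeVec (L / m) (fun k => ((j k : ℕ) : ℤ))))) *
                Ψ.ψ X).re)) / (m : ℝ) ^ 3)
    (h4 : Summit.AtomisticToContinuum.BoseEinsteinCondensation.Theses.BECInfDivCoherence.GridAverageCondensate) :
    ∀ v : ℝ → ℝ≥0∞, IsRepulsiveFiniteRange v → ∃ ρ₀ : ℝ, 0 < ρ₀ ∧ ∀ ρ : ℝ, 0 < ρ → ρ < ρ₀ →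
      ∃ c : ℝ, 0 < c ∧ ∀ᶠ N : ℕ in atTop, ∃ δ : ℝ≥0∞, 0 < δ ∧
        ∀ Ψ : PeriodicTrialState N (sideLength ρ N),
          periodicEnergy v Ψ ≤ periodicGroundStateEnergy v N (sideLength ρ N) + δ →
            ENNReal.ofReal (c * N) ≤ condensateOccupation N (sideLength ρ N) Ψ.ψ := by
  intro v hv
  obtain ⟨R₀, hR₀⟩ := hv.2
  -- a positive range bound
  set R : ℝ := max R₀ 1 with hRdef
  have hR : 0 < R := lt_max_of_lt_right one_pos
  have hvR : ∀ r, R < r → v r = 0 := fun r hr => hR₀ r ((le_max_left _ _).trans_lt hr)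
  obtain ⟨ρ₁, hρ₁, H1⟩ := hpos v hv
  obtain ⟨Λ, ρ₂, hρ₂, H2⟩ := hmean v hv 1 one_pos
  obtain ⟨ρ₃, hρ₃, H3⟩ := periodicGroundStateEnergy_le_uniform hR
  -- constants
  set c : ℝ := Real.exp (-Λ) / 2 with hc
  have hcpos : 0 < c := by positivity
  set κ : ℝ := c / 2 with hκ
  have hκpos : 0 < κ := by positivity
  set ρ₄ : ℝ := κ / (16 * Real.pi * R) with hρ₄
  have hρ₄pos : 0 < ρ₄ := by positivity
  refine ⟨min (min ρ₁ ρ₂) (min ρ₃ ρ₄), by positivity, fun ρ hρ hρlt => ?_⟩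
  have hρ1 : ρ < ρ₁ := hρlt.trans_le ((min_le_left _ _).trans (min_le_left _ _))
  have hρ2 : ρ < ρ₂ := hρlt.trans_le ((min_le_left _ _).trans (min_le_right _ _))
  have hρ3 : ρ < ρ₃ := hρlt.trans_le ((min_le_right _ _).trans (min_le_left _ _))
  have hρ4 : ρ < ρ₄ := hρlt.trans_le ((min_le_right _ _).trans (min_le_right _ _))
  -- the energy per particle `e = 16πRρ < κ`
  set e : ℝ := 16 * Real.pi * R * ρ with he
  have hepos : 0 ≤ e := by positivity
  have heκ : e < κ := by
    have : 16 * Real.pi * R * ρ < 16 * Real.pi * R * (κ / (16 * Real.pi * R)) :=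
      mul_lt_mul_of_pos_left hρ4 (by positivity)
    rwa [mul_div_cancel₀ _ (by positivity : (16 * Real.pi * R : ℝ) ≠ 0)] at this
  refine ⟨c, hcpos, ?_⟩
  have hNκ : ∀ᶠ N : ℕ in atTop, (1 : ℝ) / N ≤ κ :=
    tendsto_one_div_atTop_nhds_zero_nat.eventually (eventually_le_nhds hκpos)
  filter_upwards [H1 ρ hρ hρ1, H2 ρ hρ hρ2, H3 ρ hρ hρ3, eventually_ge_atTop 1, hNκ,
    (tendsto_sideLength_atTop hρ).eventually_ge_atTop 1] with N hN1 hN2 hN3 hN1le hNκ' hL1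
  have hN0 : 0 < N := by omega
  have hNpos : (0 : ℝ) < N := by exact_mod_cast hN0
  have hE0 : periodicGroundStateEnergy v N (sideLength ρ N) ≤ ENNReal.ofReal (e * N) := by
    have := hN3 v hvR; rwa [he]
  have hLpos : 0 < sideLength ρ N := by
    unfold sideLength; exact Real.rpow_pos_of_pos (div_pos hNpos hρ) _
  have heN : e + 1 / N ≤ 2 * κ := by linarith
  clear hN3 H1 H2 H3
  dsimp only at hN2
  generalize sideLength ρ N = L at hN1 hN2 hE0 hLpos hL1 ⊢
  -- the grid size `m = ⌊L/1⌋ ≥ 1` and spacing `h = L/m ≤ 2`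
  have hm1 : 1 ≤ ⌊L / 1⌋₊ := Nat.le_floor (by rw [Nat.cast_one, div_one]; exact hL1)
  have hmlt : L / 1 < ⌊L / 1⌋₊ + 1 := Nat.lt_floor_add_one _
  generalize hmdef : ⌊L / 1⌋₊ = m at hN2 hm1 hmlt
  haveI : NeZero m := ⟨by omega⟩
  have hm0 : 0 < m := by omega
  have hmpos : (0 : ℝ) < m := by exact_mod_cast hm0
  have hm1r : (1 : ℝ) ≤ m := by exact_mod_cast hm1
  set h : ℝ := L / m with hh
  have hhpos : 0 < h := div_pos hLpos hmpos
  have hh2 : h ≤ 2 := by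
    rw [hh, div_le_iff₀ hmpos]
    rw [div_one] at hmlt
    nlinarith
  have hh2sq : h ^ 2 ≤ 4 := by nlinarith
  obtain ⟨δ₁, hδ₁, H1'⟩ := hN1
  obtain ⟨δ₂, hδ₂, H2'⟩ := hN2
  refine ⟨min (min δ₁ δ₂) 1, lt_min (lt_min hδ₁ hδ₂) one_pos, fun Ψ hΨ => ?_⟩
  have hΨ1 : periodicEnergy v Ψ ≤ periodicGroundStateEnergy v N L + δ₁ :=
    hΨ.trans (add_le_add le_rfl ((min_le_left _ _).trans (min_le_left _ _)))
  have hΨ2 : periodicEnergy v Ψ ≤ periodicGroundStateEnergy v N L + δ₂ :=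
    hΨ.trans (add_le_add le_rfl ((min_le_left _ _).trans (min_le_right _ _)))
  -- kinetic energy `≤ eN + 1`
  set T : ℝ := e * N + 1 with hT
  have hTpos : 0 ≤ T := by positivity
  have hkin : (∫⁻ X in cellN N L, kineticDensity Ψ.ψ X) ≤ ENNReal.ofReal T :=
    calc (∫⁻ X in cellN N L, kineticDensity Ψ.ψ X) ≤ periodicEnergy v Ψ :=
          lintegral_kineticDensity_le_periodicEnergy v Ψ
      _ ≤ periodicGroundStateEnergy v N L + min (min δ₁ δ₂) 1 := hΨ
      _ ≤ ENNReal.ofReal (e * N) + 1 := add_le_add hE0 (min_le_right _ _)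
      _ = ENNReal.ofReal T := by
          rw [hT, ENNReal.ofReal_add (by positivity) zero_le_one, ENNReal.ofReal_one]
  -- any particle will do: take `i = 0`
  set i : Fin N := ⟨0, hN0⟩ with hi
  set G : Space → ℝ := fun r =>
    (∫ X in cellN N L, conj (Ψ.ψ (Function.update X i (X i + r))) * Ψ.ψ X).re with hGdef
  have hGpos : ∀ r, 0 < G r := H1' Ψ hΨ1 i
  have hmeanF : -Λ ≤ (∑ j : Fin 3 → Fin m,
      Real.log (G (latticeVec h fun k => ((j k : ℕ) : ℤ)))) / (m : ℝ) ^ 3 := H2' Ψ hΨ2 i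
  have h4i : ENNReal.ofReal (N * (∑ j : Fin 3 → Fin m, G (latticeVec h fun k => ((j k : ℕ) : ℤ))) /
      (m : ℝ) ^ 3 - T * h ^ 2 / (4 * Real.pi ^ 2)) ≤ condensateOccupation N L Ψ.ψ :=
    h4 N m L T hLpos hm0 hTpos Ψ hkin i
  clear_value G
  -- AM–GM: grid average of `G` is at least `exp(mean log G) ≥ exp(-Λ) = 2c`
  have havg : 2 * c ≤ (∑ j : Fin 3 → Fin m, G (latticeVec h fun k => ((j k : ℕ) : ℤ))) / (m : ℝ) ^ 3 := by
    have hJ := exp_mean_log_le_mean (fun j : Fin 3 → Fin m => G (latticeVec h fun k => ((j k : ℕ) : ℤ)))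
      (fun j => hGpos _)
    have hcard : (Fintype.card (Fin 3 → Fin m) : ℝ) = (m : ℝ) ^ 3 := by
      rw [Fintype.card_fun, Fintype.card_fin, Fintype.card_fin, Nat.cast_pow]
    rw [hcard] at hJ
    calc 2 * c = Real.exp (-Λ) := by rw [hc]; ring
      _ ≤ Real.exp ((∑ j : Fin 3 → Fin m,
          Real.log (G (latticeVec h fun k => ((j k : ℕ) : ℤ)))) / (m : ℝ) ^ 3) :=
          Real.exp_le_exp.2 hmeanF
      _ ≤ _ := hJ
  -- `GridAverageCondensate` and the error term `T h²/(4π²) ≤ c N`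
  refine le_trans (ENNReal.ofReal_le_ofReal ?_) h4i
  have hπ : 1 ≤ Real.pi ^ 2 := one_le_pow₀ (by linarith only [Real.pi_gt_three])
  have hTerr : T * h ^ 2 / (4 * Real.pi ^ 2) ≤ c * N := by
    have hTh : 0 ≤ T * h ^ 2 := by positivity
    calc T * h ^ 2 / (4 * Real.pi ^ 2) ≤ T * h ^ 2 / 4 :=
          div_le_div_of_nonneg_left hTh (by norm_num) (by linarith only [hπ])
      _ ≤ T := by
          have := mul_le_mul_of_nonneg_left hh2sq hTpos; linarith only [this]
      _ = N * (e + 1 / N) := by rw [hT]; field_simp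
      _ ≤ N * (2 * κ) := by gcongr
      _ = c * N := by rw [hκ]; ring
  have hmain := mul_le_mul_of_nonneg_left havg hNpos.le
  rw [mul_div_assoc]
  linarith only [hmain, hTerr]

/-! ### Corollaries -/

/-- Positivity of the coherence of near-minimisers is the first conjunct of the sister crux
`GridInfDivCoherence` (take `ε = 1`; its `∀ r` serves every grid scale). [folklore] -/
theorem coherencePos_of_gridInfDivCoherence
    (h1 : Summit.AtomisticToContinuum.BoseEinsteinCondensation.Theses.BECInfDivCoherence.GridInfDivCoherence) :
    ∀ v : ℝ → ℝ≥0∞, IsRepulsiveFiniteRange v → ∃ ρ₀ : ℝ, 0 < ρ₀ ∧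
      ∀ ρ : ℝ, 0 < ρ → ρ < ρ₀ → ∀ᶠ N : ℕ in atTop, ∃ δ : ℝ≥0∞, 0 < δ ∧
        ∀ Ψ : PeriodicTrialState N (sideLength ρ N),
          periodicEnergy v Ψ ≤ periodicGroundStateEnergy v N (sideLength ρ N) + δ → ∀ i : Fin N,
            ∀ r, 0 < (∫ X in cellN N (sideLength ρ N),
              conj (Ψ.ψ (Function.update X i (X i + r))) * Ψ.ψ X).re := by
  intro v hv
  obtain ⟨η, _hη, ρ₀, hρ₀, H⟩ := h1 v hv
  refine ⟨ρ₀, hρ₀, fun ρ hρ hρlt => ?_⟩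
  filter_upwards [H ρ hρ hρlt] with N hN
  obtain ⟨δ, hδ, H'⟩ := hN 1 one_pos
  exact ⟨δ, hδ, fun Ψ hΨ i => (H' Ψ hΨ i).1⟩

/-- **The crux is target-strength.** `LevyNegativeMoment` (stmt-9115) together with positivity of
the coherence of near-minimisers already yields constant-mode BEC of near-minimisers at every small
density (the body of `BECPeriodicReduction.PeriodicBEC`, stmt-0826, and the conclusion of the glue
`LevyMassCondensation`), with `GridAverageCondensate` discharged by `gridAverageCondensate_proof`:
the sign condition `ν̃ ≥ −ε` of `GridInfDivCoherence` is not used. [folklore] -/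
theorem periodicBEC_of_levyNegativeMoment_of_coherencePos
    (hpos : ∀ v : ℝ → ℝ≥0∞, IsRepulsiveFiniteRange v → ∃ ρ₀ : ℝ, 0 < ρ₀ ∧
      ∀ ρ : ℝ, 0 < ρ → ρ < ρ₀ → ∀ᶠ N : ℕ in atTop, ∃ δ : ℝ≥0∞, 0 < δ ∧
        ∀ Ψ : PeriodicTrialState N (sideLength ρ N),
          periodicEnergy v Ψ ≤ periodicGroundStateEnergy v N (sideLength ρ N) + δ → ∀ i : Fin N,
            ∀ r, 0 < (∫ X in cellN N (sideLength ρ N),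
              conj (Ψ.ψ (Function.update X i (X i + r))) * Ψ.ψ X).re)
    (h2 : Summit.AtomisticToContinuum.BoseEinsteinCondensation.Theses.BECInfDivCoherence.LevyNegativeMoment) :
    ∀ v : ℝ → ℝ≥0∞, IsRepulsiveFiniteRange v → ∃ ρ₀ : ℝ, 0 < ρ₀ ∧ ∀ ρ : ℝ, 0 < ρ → ρ < ρ₀ →
      ∃ c : ℝ, 0 < c ∧ ∀ᶠ N : ℕ in atTop, ∃ δ : ℝ≥0∞, 0 < δ ∧
        ∀ Ψ : PeriodicTrialState N (sideLength ρ N),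
          periodicEnergy v Ψ ≤ periodicGroundStateEnergy v N (sideLength ρ N) + δ →
            ENNReal.ofReal (c * N) ≤ condensateOccupation N (sideLength ρ N) Ψ.ψ :=
  periodicBEC_of_gridMeanLog_of_coherencePos hpos (gridMeanLog_of_levyNegativeMoment h2)
    gridAverageCondensate_proof

/-- **The glue with the sister crux weakened to positivity**: `GridInfDivCoherence → LevyNegativeMoment →
PeriodicBEC-body` using only the positivity conjunct of `GridInfDivCoherence` (compare
`levyMassCondensation_proof`, which also consumes its sign condition). [folklore] -/
theorem periodicBEC_of_gridInfDivCoherence_pos_of_levyNegativeMoment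
    (h1 : Summit.AtomisticToContinuum.BoseEinsteinCondensation.Theses.BECInfDivCoherence.GridInfDivCoherence)
    (h2 : Summit.AtomisticToContinuum.BoseEinsteinCondensation.Theses.BECInfDivCoherence.LevyNegativeMoment) :
    ∀ v : ℝ → ℝ≥0∞, IsRepulsiveFiniteRange v → ∃ ρ₀ : ℝ, 0 < ρ₀ ∧ ∀ ρ : ℝ, 0 < ρ → ρ < ρ₀ →
      ∃ c : ℝ, 0 < c ∧ ∀ᶠ N : ℕ in atTop, ∃ δ : ℝ≥0∞, 0 < δ ∧
        ∀ Ψ : PeriodicTrialState N (sideLength ρ N),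
          periodicEnergy v Ψ ≤ periodicGroundStateEnergy v N (sideLength ρ N) + δ →
            ENNReal.ofReal (c * N) ≤ condensateOccupation N (sideLength ρ N) Ψ.ψ :=
  periodicBEC_of_levyNegativeMoment_of_coherencePos (coherencePos_of_gridInfDivCoherence h1) h2

/-- **The stub is target-strength** (`promote-stub`, lead c1, made kernel-checked): the registered
stub `stub_logClusterL1` of line `registered` (inline, verbatim its registered signature) together
with positivity of the coherence of near-minimisers already yields constant-mode BEC of
near-minimisers at every small density — bypassing the line's other stubs and the crux. [folklore] -/
theorem periodicBEC_of_logClusterL1_of_coherencePos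
    (hpos : ∀ v : ℝ → ℝ≥0∞, IsRepulsiveFiniteRange v → ∃ ρ₀ : ℝ, 0 < ρ₀ ∧
      ∀ ρ : ℝ, 0 < ρ → ρ < ρ₀ → ∀ᶠ N : ℕ in atTop, ∃ δ : ℝ≥0∞, 0 < δ ∧
        ∀ Ψ : PeriodicTrialState N (sideLength ρ N),
          periodicEnergy v Ψ ≤ periodicGroundStateEnergy v N (sideLength ρ N) + δ → ∀ i : Fin N,
            ∀ r, 0 < (∫ X in cellN N (sideLength ρ N),
              conj (Ψ.ψ (Function.update X i (X i + r))) * Ψ.ψ X).re)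
    (h1 : ∀ v : ℝ → ENNReal, Literature.MathematicalPhysics.QuantumManyBody.BoseGas.IsRepulsiveFiniteRange v → ∀ η : ℝ, 0 < η → ∃ C : ℝ, ∃ ρ₀ : ℝ, 0 < ρ₀ ∧ ∀ ρ : ℝ, 0 < ρ → ρ < ρ₀ → ∀ᶠ N : ℕ in Filter.atTop, ∃ δ : ENNReal, 0 < δ ∧ ∀ Ψ : Literature.MathematicalPhysics.QuantumManyBody.BoseGas.PeriodicTrialState N (Literature.MathematicalPhysics.QuantumManyBody.BoseGas.sideLength ρ N), Literature.MathematicalPhysics.QuantumManyBody.BoseGas.periodicEnergy v Ψ ≤ Literature.MathematicalPhysics.QuantumManyBody.BoseGas.periodicGroundStateEnergy v N (Literature.MathematicalPhysics.QuantumManyBody.BoseGas.sideLength ρ N) + δ → ∀ i : Fin N, let L : ℝ := Literature.MathematicalPhysics.QuantumManyBody.BoseGas.sideLength ρ N; let m : ℕ := ⌊L / η⌋₊; let G : EuclideanSpace ℝ (Fin 3) → ℝ := fun r => (∫ X in Literature.MathematicalPhysics.QuantumManyBody.BoseGas.cellN N L, conj (Ψ.ψ (Function.update X i (X i + r))) *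 Ψ.ψ X).re; ∃ c : ℝ, (∑ j : Fin 3 → Fin m, |Real.log (G (Literature.MathematicalPhysics.QuantumManyBody.BoseGas.latticeVec (L / m) (fun k => ((j k : ℕ) : ℤ)))) - c| * ((L / m) / (1 + ∑ k, ((min (j k : ℕ) (m - (j k : ℕ)) : ℕ) : ℝ) ^ 2))) ≤ C) :
    ∀ v : ℝ → ℝ≥0∞, IsRepulsiveFiniteRange v → ∃ ρ₀ : ℝ, 0 < ρ₀ ∧ ∀ ρ : ℝ, 0 < ρ → ρ < ρ₀ →
      ∃ c : ℝ, 0 < c ∧ ∀ᶠ N : ℕ in atTop, ∃ δ : ℝ≥0∞, 0 < δ ∧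
        ∀ Ψ : PeriodicTrialState N (sideLength ρ N),
          periodicEnergy v Ψ ≤ periodicGroundStateEnergy v N (sideLength ρ N) + δ →
            ENNReal.ofReal (c * N) ≤ condensateOccupation N (sideLength ρ N) Ψ.ψ :=
  periodicBEC_of_gridMeanLog_of_coherencePos hpos (gridMeanLog_of_logClusterL1 h1)
    gridAverageCondensate_proof

end Summit.AtomisticToContinuum.BoseEinsteinCondensation.Theorems

end
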